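import Mathlib
import HarnessLib
import Summits.Ventures.LatticeQCDFlow.Exactness.U1LeapfrogTrajectory

/-!
# Near-free-flight calculus for kick/drift splitting words on `U(1)` lattice gauge fields: append a kick, append a drift, take a power

HONEST FRAMING: exact (Metropolis-corrected) sampling algorithms for lattice gauge theory;
figures of merit are autocorrelation/cost numbers at stated couplings and volumes; no
continuum-physics claim.

Venture `LatticeQCDFlow` (cell pub-lqcd), topic `Exactness`, FANOUT row 14 (`eng-flowhmc`, engine
`latflow.fthmc`, family B, `U(1)` rung; integrator menu `leapfrog` / `omf2` / `omf4`, any `n_md`).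
NEW WORK of the cell over the tree's `SplittingIntegrator.lean` (`kick`, `drift`, `mulDrift`),
`U1LeapfrogHMC.lean` (`u1ExpDrift`) and this row's `U1LeapfrogTrajectory.lean`
(`dist_u1ExpDrift_mul_le`, `u1ExpDrift_add'`, `u1ExpDrift_zero'`); nothing is cited as a fact; no
number.  `U1LeapfrogTrajectory.lean` unfolded the `n`-fold LEAPFROG word; this file is the
integrator-independent version, so that OMF2 / OMF4 and any other palindromic kick/drift word are
covered by the same Doeblin argument (`U1WordDoeblin.lean`).

On the abelian rung every composite of kicks `(v, q) ↦ (v, q + g v)` and drifts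
`(v, q) ↦ (e_c(q)·v, q)` is a NEAR-FREE-FLIGHT MAP

  `Φ (v, q) = (e₁(τ • q + A v q) · v, q + B v q)`        (`e₁ = u1ExpDrift 1`)

with a total drift time `τ` and deviation maps `A, B` carrying SIX constants: sup bounds
`‖A v q‖ ≤ α₀`, `‖B v q‖ ≤ β₀` and joint Lipschitz bounds
`‖A v q − A v' q'‖ ≤ α₁ dist(v,v') + α₂ ‖q − q'‖`, `‖B v q − B v' q'‖ ≤ β₁ dist(v,v') + β₂ ‖q − q'‖`
(chordal sup metric on `U(1)^ι`, sup norm on momenta).  This file proves: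

* §1 tools: `u1ExpDrift_eq_one_smul` (`e_c(q) = e₁(c • q)`), `dist_mul_left_le_pi_circle`,
  `dist_u1ExpDrift_one_mul_le` (`dist(e₁(a)·v, e₁(a')·v') ≤ ‖a − a'‖ + dist(v, v')`);
* §2 `nearFreeFlight_id` (the identity: `τ = 0`, all constants `0`), **`nearFreeFlight_kick`** (append a
  kick `g` with `‖g‖ ≤ b`, `g` `L`-Lipschitz: `τ, A` unchanged, `B ↦ B + g ∘ (configuration)`,
  `β₀ + b`, `β₁ + L(1 + α₁)`, `β₂ + L(|τ| + α₂)`), **`nearFreeFlight_drift`** (append a drift by `c`: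
  `τ ↦ τ + c`, `A ↦ A + c • B`, `α₀ + |c|β₀`, `α₁ + |c|β₁`, `α₂ + |c|β₂`; `B` unchanged);
* §3 **`nearFreeFlight_iterate`** — THE POWER LEMMA (discrete Grönwall with a bootstrap): from a fixed
  configuration `u`, under the short-trajectory conditions
  `3 (β₁ τ² n² + (α₁ + β₂) |τ| n + 2 α₂) ≤ |τ|` and `β₁ |τ| n² + 2 β₂ n ≤ 1`, for every `k ≤ n`:
  `Φ^[k] (u, p) = (e₁((k τ) • p + α_k p) · u, p + β_k p)` with `‖α_k‖ ≤ k α₀ + |τ| β₀ k²/2`,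
  `‖β_k‖ ≤ k β₀`, `Lip α_k ≤ β₁ τ² k³ + (α₁ + β₂)|τ| k² + 2 α₂ k (≤ k|τ|/3)`, `Lip β_k ≤ β₁|τ| k² + 2 β₂ k (≤ 1)`;
  `nearFreeFlight_iterate_fst` — the reading the Doeblin argument consumes: the configuration after
  `n` applications is ONE drift `e₁((nτ) • p + G_u p) · u` with `‖G_u‖ ≤ n α₀ + |τ| β₀ n²/2` and
  `G_u` `(n|τ|/3)`-Lipschitz; `nearFreeFlight_iterate_snd` — `‖(Φ^[n] (u,p)).2 − p‖ ≤ n β₀`.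

NOT here: kernels (`U1WordDoeblin.lean`), instances, sharp constants, `SU(2)`.
-/

noncomputable section

namespace Summit.Ventures.LatticeQCDFlow.Exactness

open Set Metric
open scoped NNReal

variable {ι : Type*}

/-! ## §1 Tools -/

/-- `e_c(q) = e₁(c • q)`. -/
theorem u1ExpDrift_eq_one_smul (c : ℝ) (q : ι → ℝ) : u1ExpDrift c q = u1ExpDrift 1 (c • q) := by
  funext l
  simp only [u1ExpDrift_apply, Pi.smul_apply, smul_eq_mul, one_mul]

variable [Fintype ι]

/-- Left multiplication is `1`-Lipschitz on `U(1)^ι` (it is an isometry; the inequality suffices). -/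
theorem dist_mul_left_le_pi_circle (w v v' : ι → Circle) : dist (w * v) (w * v') ≤ dist v v' := by
  refine (dist_pi_le_iff dist_nonneg).2 fun l => ?_
  simp only [Pi.mul_apply]
  change dist ((w l * v l : Circle) : ℂ) ((w l * v' l : Circle) : ℂ) ≤ _
  rw [dist_eq_norm, Circle.coe_mul, Circle.coe_mul, ← mul_sub, norm_mul, Circle.norm_coe, one_mul,
    ← dist_eq_norm]
  exact dist_le_pi_dist v v' l

/-- **Two drifted configurations**: `dist(e₁(a)·v, e₁(a')·v') ≤ ‖a − a'‖ + dist(v, v')`. -/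
theorem dist_u1ExpDrift_one_mul_le (a a' : ι → ℝ) (v v' : ι → Circle) :
    dist (u1ExpDrift 1 a * v) (u1ExpDrift 1 a' * v') ≤ ‖a - a'‖ + dist v v' := by
  calc dist (u1ExpDrift 1 a * v) (u1ExpDrift 1 a' * v')
      ≤ dist (u1ExpDrift 1 a * v) (u1ExpDrift 1 a' * v) +
          dist (u1ExpDrift 1 a' * v) (u1ExpDrift 1 a' * v') := dist_triangle _ _ _
    _ ≤ |(1 : ℝ)| * ‖a - a'‖ + dist v v' :=
        add_le_add (dist_u1ExpDrift_mul_le 1 a a' v) (dist_mul_left_le_pi_circle _ v v')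
    _ = ‖a - a'‖ + dist v v' := by rw [abs_one, one_mul]

/-! ## §2 Near-free-flight maps: the identity, appending a kick, appending a drift -/

section Append

variable {Φ : (ι → Circle) × (ι → ℝ) → (ι → Circle) × (ι → ℝ)} {τ : ℝ}
  {A B : (ι → Circle) → (ι → ℝ) → ι → ℝ} {α₀ α₁ α₂ β₀ β₁ β₂ : ℝ}

omit [Fintype ι] in
/-- **The identity is a near-free-flight map** with `τ = 0`, `A = B = 0`. -/
theorem nearFreeFlight_id (z : (ι → Circle) × (ι → ℝ)) :
    id z = (u1ExpDrift 1 ((0 : ℝ) • z.2 + (fun (_ : ι → Circle) (_ : ι → ℝ) => (0 : ι → ℝ)) z.1 z.2) * z.1,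
      z.2 + (fun (_ : ι → Circle) (_ : ι → ℝ) => (0 : ι → ℝ)) z.1 z.2) := by
  simp only [id, zero_smul, add_zero, u1ExpDrift_zero', one_mul]

omit [Fintype ι] in
/-- **Appending a kick** `(v, q) ↦ (v, q + g v)`: the configuration and `τ, A` are unchanged, the
momentum deviation becomes `B v q + g (e₁(τ • q + A v q) · v)`. -/
theorem nearFreeFlight_kick
    (hΦ : ∀ z : (ι → Circle) × (ι → ℝ), Φ z = (u1ExpDrift 1 (τ • z.2 + A z.1 z.2) * z.1, z.2 + B z.1 z.2))
    (g : (ι → Circle) → ι → ℝ) (z : (ι → Circle) × (ι → ℝ)) :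
    (⇑(kick g) ∘ Φ) z = (u1ExpDrift 1 (τ • z.2 + A z.1 z.2) * z.1,
      z.2 + (fun v q => B v q + g (u1ExpDrift 1 (τ • q + A v q) * v)) z.1 z.2) := by
  rw [Function.comp_apply, hΦ z]
  change (_, _ + g _) = _
  dsimp only
  rw [add_assoc]

/-- The bounds after appending a kick with `‖g‖ ≤ b`, `g` `L`-Lipschitz: sup `β₀ + b`, Lipschitz
`(β₁ + L(1 + α₁)) dist(v,v') + (β₂ + L(|τ| + α₂)) ‖q − q'‖`. -/
theorem nearFreeFlight_kick_bounds (hB0 : ∀ v q, ‖B v q‖ ≤ β₀)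
    (hA : ∀ v v' q q', ‖A v q - A v' q'‖ ≤ α₁ * dist v v' + α₂ * ‖q - q'‖)
    (hB : ∀ v v' q q', ‖B v q - B v' q'‖ ≤ β₁ * dist v v' + β₂ * ‖q - q'‖)
    {g : (ι → Circle) → ι → ℝ} {b : ℝ} {L : ℝ≥0} (hb : ∀ v, ‖g v‖ ≤ b) (hL : LipschitzWith L g) :
    (∀ v q, ‖(fun v q => B v q + g (u1ExpDrift 1 (τ • q + A v q) * v)) v q‖ ≤ β₀ + b) ∧
    (∀ v v' q q', ‖(fun v q => B v q + g (u1ExpDrift 1 (τ • q + A v q) * v)) v q -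
        (fun v q => B v q + g (u1ExpDrift 1 (τ • q + A v q) * v)) v' q'‖ ≤
      (β₁ + L * (1 + α₁)) * dist v v' + (β₂ + L * (|τ| + α₂)) * ‖q - q'‖) := by
  refine ⟨fun v q => (norm_add_le _ _).trans (add_le_add (hB0 v q) (hb _)), fun v v' q q' => ?_⟩
  dsimp only
  have hg := hL.dist_le_mul (u1ExpDrift 1 (τ • q + A v q) * v) (u1ExpDrift 1 (τ • q' + A v' q') * v')
  rw [dist_eq_norm] at hg
  have hd := dist_u1ExpDrift_one_mul_le (τ • q + A v q) (τ • q' + A v' q') v v'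
  have harg : ‖(τ • q + A v q) - (τ • q' + A v' q')‖ ≤ |τ| * ‖q - q'‖ + (α₁ * dist v v' + α₂ * ‖q - q'‖) := by
    calc ‖(τ • q + A v q) - (τ • q' + A v' q')‖ = ‖τ • (q - q') + (A v q - A v' q')‖ := by
          rw [smul_sub]; congr 1; abel
      _ ≤ ‖τ • (q - q')‖ + ‖A v q - A v' q'‖ := norm_add_le _ _
      _ ≤ |τ| * ‖q - q'‖ + (α₁ * dist v v' + α₂ * ‖q - q'‖) := by
          rw [norm_smul, Real.norm_eq_abs]; exact add_le_add le_rfl (hA v v' q q')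
  have hL0 : (0 : ℝ) ≤ L := NNReal.coe_nonneg L
  calc ‖B v q + g (u1ExpDrift 1 (τ • q + A v q) * v) - (B v' q' + g (u1ExpDrift 1 (τ • q' + A v' q') * v'))‖
      = ‖(B v q - B v' q') + (g (u1ExpDrift 1 (τ • q + A v q) * v) -
          g (u1ExpDrift 1 (τ • q' + A v' q') * v'))‖ := by congr 1; abel
    _ ≤ ‖B v q - B v' q'‖ + ‖g (u1ExpDrift 1 (τ • q + A v q) * v) -
          g (u1ExpDrift 1 (τ • q' + A v' q') * v')‖ := norm_add_le _ _
    _ ≤ (β₁ * dist v v' + β₂ * ‖q - q'‖) +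
          L * (|τ| * ‖q - q'‖ + (α₁ * dist v v' + α₂ * ‖q - q'‖) + dist v v') :=
        add_le_add (hB v v' q q') (hg.trans (mul_le_mul_of_nonneg_left (hd.trans
          (add_le_add harg le_rfl)) hL0))
    _ = (β₁ + L * (1 + α₁)) * dist v v' + (β₂ + L * (|τ| + α₂)) * ‖q - q'‖ := by ring

omit [Fintype ι] in
/-- **Appending a drift** `(v, q) ↦ (e_c(q) · v, q)`: `τ ↦ τ + c`, `A ↦ A + c • B`, `B` unchanged. -/
theorem nearFreeFlight_drift
    (hΦ : ∀ z : (ι → Circle) × (ι → ℝ), Φ z = (u1ExpDrift 1 (τ • z.2 + A z.1 z.2) * z.1, z.2 + B z.1 z.2))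
    (c : ℝ) (z : (ι → Circle) × (ι → ℝ)) :
    (⇑(drift (mulDrift (u1ExpDrift c))) ∘ Φ) z =
      (u1ExpDrift 1 ((τ + c) • z.2 + (fun v q => A v q + c • B v q) z.1 z.2) * z.1, z.2 + B z.1 z.2) := by
  rw [Function.comp_apply, hΦ z]
  change (mulDrift (u1ExpDrift c) (z.2 + B z.1 z.2) (u1ExpDrift 1 (τ • z.2 + A z.1 z.2) * z.1), _) = _
  refine Prod.ext ?_ rfl
  simp only [mulDrift, Equiv.coe_mulLeft]
  rw [← mul_assoc, u1ExpDrift_eq_one_smul c, ← u1ExpDrift_add']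
  congr 2
  rw [smul_add, add_smul]
  abel

/-- The bounds after appending a drift by `c`: sup `α₀ + |c| β₀`, Lipschitz
`(α₁ + |c|β₁) dist(v,v') + (α₂ + |c|β₂) ‖q − q'‖`. -/
theorem nearFreeFlight_drift_bounds (hA0 : ∀ v q, ‖A v q‖ ≤ α₀) (hB0 : ∀ v q, ‖B v q‖ ≤ β₀)
    (hA : ∀ v v' q q', ‖A v q - A v' q'‖ ≤ α₁ * dist v v' + α₂ * ‖q - q'‖)
    (hB : ∀ v v' q q', ‖B v q - B v' q'‖ ≤ β₁ * dist v v' + β₂ * ‖q - q'‖) (c : ℝ) :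
    (∀ v q, ‖(fun v q => A v q + c • B v q) v q‖ ≤ α₀ + |c| * β₀) ∧
    (∀ v v' q q', ‖(fun v q => A v q + c • B v q) v q - (fun v q => A v q + c • B v q) v' q'‖ ≤
      (α₁ + |c| * β₁) * dist v v' + (α₂ + |c| * β₂) * ‖q - q'‖) := by
  refine ⟨fun v q => ?_, fun v v' q q' => ?_⟩
  · dsimp only
    refine (norm_add_le _ _).trans (add_le_add (hA0 v q) ?_)
    rw [norm_smul, Real.norm_eq_abs]
    exact mul_le_mul_of_nonneg_left (hB0 v q) (abs_nonneg c)
  · dsimp only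
    calc ‖A v q + c • B v q - (A v' q' + c • B v' q')‖
        = ‖(A v q - A v' q') + c • (B v q - B v' q')‖ := by rw [smul_sub]; congr 1; abel
      _ ≤ ‖A v q - A v' q'‖ + ‖c • (B v q - B v' q')‖ := norm_add_le _ _
      _ ≤ (α₁ * dist v v' + α₂ * ‖q - q'‖) + |c| * (β₁ * dist v v' + β₂ * ‖q - q'‖) := by
          rw [norm_smul, Real.norm_eq_abs]
          exact add_le_add (hA v v' q q') (mul_le_mul_of_nonneg_left (hB v v' q q') (abs_nonneg c))
      _ = (α₁ + |c| * β₁) * dist v v' + (α₂ + |c| * β₂) * ‖q - q'‖ := by ring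

end Append

/-! ## §3 The power lemma -/

section Power

variable {Φ : (ι → Circle) × (ι → ℝ) → (ι → Circle) × (ι → ℝ)} {τ : ℝ}
  {A B : (ι → Circle) → (ι → ℝ) → ι → ℝ} {α₀ α₁ α₂ β₀ β₁ β₂ : ℝ}

/-- **THE POWER LEMMA (near-free-flight maps, discrete Grönwall with a bootstrap).**  `Φ` a
near-free-flight map with total drift `τ` and constants `α₀, α₁, α₂, β₀, β₁, β₂ ≥ 0`; `u` a fixed
configuration; short-trajectory conditions `3 (β₁ τ² n² + (α₁ + β₂)|τ| n + 2 α₂) ≤ |τ|` and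
`β₁ |τ| n² + 2 β₂ n ≤ 1`.  Then for every `k ≤ n` there are deviation maps `α_k, β_k` with
`Φ^[k] (u, p) = (e₁((kτ) • p + α_k p) · u, p + β_k p)`, `‖α_k p‖ ≤ k α₀ + |τ| β₀ k²/2`,
`‖β_k p‖ ≤ k β₀`, `‖α_k p − α_k p'‖ ≤ (β₁ τ² k³ + (α₁ + β₂)|τ| k² + 2 α₂ k) ‖p − p'‖`,
`‖β_k p − β_k p'‖ ≤ (β₁ |τ| k² + 2 β₂ k) ‖p − p'‖`. -/
theorem nearFreeFlight_iterate
    (hΦ : ∀ z : (ι → Circle) × (ι → ℝ), Φ z = (u1ExpDrift 1 (τ • z.2 + A z.1 z.2) * z.1, z.2 + B z.1 z.2))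
    (hA0 : ∀ v q, ‖A v q‖ ≤ α₀) (hB0 : ∀ v q, ‖B v q‖ ≤ β₀)
    (hA : ∀ v v' q q', ‖A v q - A v' q'‖ ≤ α₁ * dist v v' + α₂ * ‖q - q'‖)
    (hB : ∀ v v' q q', ‖B v q - B v' q'‖ ≤ β₁ * dist v v' + β₂ * ‖q - q'‖)
    (hα₁ : 0 ≤ α₁) (hα₂ : 0 ≤ α₂) (hβ₁ : 0 ≤ β₁) (hβ₂ : 0 ≤ β₂) (u : ι → Circle) {n : ℕ}
    (h1 : 3 * (β₁ * |τ| ^ 2 * (n : ℝ) ^ 2 + (α₁ + β₂) * |τ| * n + 2 * α₂) ≤ |τ|)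
    (h2 : β₁ * |τ| * (n : ℝ) ^ 2 + 2 * β₂ * n ≤ 1) :
    ∀ k : ℕ, k ≤ n → ∃ α β : (ι → ℝ) → ι → ℝ,
      (∀ p, Φ^[k] (u, p) = (u1ExpDrift 1 (((k : ℝ) * τ) • p + α p) * u, p + β p)) ∧
      (∀ p, ‖α p‖ ≤ k * α₀ + |τ| * β₀ * (k : ℝ) ^ 2 / 2) ∧ (∀ p, ‖β p‖ ≤ k * β₀) ∧
      (∀ p p', ‖α p - α p'‖ ≤
        (β₁ * |τ| ^ 2 * (k : ℝ) ^ 3 + (α₁ + β₂) * |τ| * (k : ℝ) ^ 2 + 2 * α₂ * k) * ‖p - p'‖) ∧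
      (∀ p p', ‖β p - β p'‖ ≤ (β₁ * |τ| * (k : ℝ) ^ 2 + 2 * β₂ * k) * ‖p - p'‖) := by
  have hα0 : 0 ≤ α₀ := (norm_nonneg _).trans (hA0 (fun _ => 1) 0)
  have hβ0 : 0 ≤ β₀ := (norm_nonneg _).trans (hB0 (fun _ => 1) 0)
  have hτ : 0 ≤ |τ| := abs_nonneg τ
  intro k
  induction k with
  | zero =>
    intro _
    refine ⟨fun _ => 0, fun _ => 0, fun p => ?_, by simp, by simp, by simp, by simp⟩
    rw [Function.iterate_zero, id, Nat.cast_zero, zero_mul, zero_smul, add_zero,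
      u1ExpDrift_zero', one_mul, add_zero]
  | succ k ih =>
    intro hk
    obtain ⟨α, β, hW, hαb, hβb, hαL, hβL⟩ := ih (Nat.le_of_succ_le hk)
    have hkn : (k : ℝ) ≤ n := by exact_mod_cast Nat.le_of_succ_le hk
    have hkk : (0 : ℝ) ≤ k := Nat.cast_nonneg k
    -- the Lipschitz constants so far and their bootstrap bounds `X ≤ k|τ|`, `Y ≤ 1`
    set X : ℝ := β₁ * |τ| ^ 2 * (k : ℝ) ^ 3 + (α₁ + β₂) * |τ| * (k : ℝ) ^ 2 + 2 * α₂ * k with hX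
    set Y : ℝ := β₁ * |τ| * (k : ℝ) ^ 2 + 2 * β₂ * k with hY
    have hX0 : 0 ≤ X := by positivity
    have hY0 : 0 ≤ Y := by positivity
    have hYle : Y ≤ 1 := by
      rw [hY]; nlinarith [mul_nonneg hβ₁ hτ, pow_le_pow_left₀ hkk hkn 2]
    have hXle : X ≤ k * |τ| := by
      have hmono : β₁ * |τ| ^ 2 * (k : ℝ) ^ 2 + (α₁ + β₂) * |τ| * k + 2 * α₂ ≤
          β₁ * |τ| ^ 2 * (n : ℝ) ^ 2 + (α₁ + β₂) * |τ| * n + 2 * α₂ := by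
        nlinarith [mul_nonneg hβ₁ (pow_nonneg hτ 2), mul_nonneg (add_nonneg hα₁ hβ₂) hτ,
          pow_le_pow_left₀ hkk hkn 2]
      have hXeq : X = k * (β₁ * |τ| ^ 2 * (k : ℝ) ^ 2 + (α₁ + β₂) * |τ| * k + 2 * α₂) := by
        rw [hX]; ring
      rw [hXeq]
      refine mul_le_mul_of_nonneg_left ?_ hkk
      linarith
    -- the new deviation maps
    set U : (ι → ℝ) → ι → Circle := fun p => u1ExpDrift 1 (((k : ℝ) * τ) • p + α p) * u with hU
    set α' : (ι → ℝ) → ι → ℝ := fun p => α p + τ • β p + A (U p) (p + β p) with hα'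
    set β' : (ι → ℝ) → ι → ℝ := fun p => β p + B (U p) (p + β p) with hβ'
    -- Lipschitz constant of the configuration so far
    have hUL : ∀ p p', dist (U p) (U p') ≤ (k * |τ| + X) * ‖p - p'‖ := by
      intro p p'
      refine (dist_u1ExpDrift_mul_le 1 _ _ u).trans ?_
      rw [abs_one, one_mul]
      calc ‖((k : ℝ) * τ) • p + α p - (((k : ℝ) * τ) • p' + α p')‖
          = ‖((k : ℝ) * τ) • (p - p') + (α p - α p')‖ := by rw [smul_sub]; congr 1; abel
        _ ≤ ‖((k : ℝ) * τ) • (p - p')‖ + ‖α p - α p'‖ := norm_add_le _ _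
        _ ≤ k * |τ| * ‖p - p'‖ + X * ‖p - p'‖ := by
            rw [norm_smul, Real.norm_eq_abs, abs_mul, abs_of_nonneg hkk]
            exact add_le_add le_rfl (hαL p p')
        _ = (k * |τ| + X) * ‖p - p'‖ := by ring
    have hqL : ∀ p p', ‖(p + β p) - (p' + β p')‖ ≤ (1 + Y) * ‖p - p'‖ := by
      intro p p'
      calc ‖(p + β p) - (p' + β p')‖ = ‖(p - p') + (β p - β p')‖ := by congr 1; abel
        _ ≤ ‖p - p'‖ + ‖β p - β p'‖ := norm_add_le _ _
        _ ≤ ‖p - p'‖ + Y * ‖p - p'‖ := add_le_add le_rfl (hβL p p')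
        _ = (1 + Y) * ‖p - p'‖ := by ring
    have hAL : ∀ p p', ‖A (U p) (p + β p) - A (U p') (p' + β p')‖ ≤
        (α₁ * (k * |τ| + X) + α₂ * (1 + Y)) * ‖p - p'‖ := by
      intro p p'
      calc ‖A (U p) (p + β p) - A (U p') (p' + β p')‖
          ≤ α₁ * dist (U p) (U p') + α₂ * ‖(p + β p) - (p' + β p')‖ := hA _ _ _ _
        _ ≤ α₁ * ((k * |τ| + X) * ‖p - p'‖) + α₂ * ((1 + Y) * ‖p - p'‖) :=
            add_le_add (mul_le_mul_of_nonneg_left (hUL p p') hα₁)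
              (mul_le_mul_of_nonneg_left (hqL p p') hα₂)
        _ = (α₁ * (k * |τ| + X) + α₂ * (1 + Y)) * ‖p - p'‖ := by ring
    have hBL : ∀ p p', ‖B (U p) (p + β p) - B (U p') (p' + β p')‖ ≤
        (β₁ * (k * |τ| + X) + β₂ * (1 + Y)) * ‖p - p'‖ := by
      intro p p'
      calc ‖B (U p) (p + β p) - B (U p') (p' + β p')‖
          ≤ β₁ * dist (U p) (U p') + β₂ * ‖(p + β p) - (p' + β p')‖ := hB _ _ _ _
        _ ≤ β₁ * ((k * |τ| + X) * ‖p - p'‖) + β₂ * ((1 + Y) * ‖p - p'‖) :=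
            add_le_add (mul_le_mul_of_nonneg_left (hUL p p') hβ₁)
              (mul_le_mul_of_nonneg_left (hqL p p') hβ₂)
        _ = (β₁ * (k * |τ| + X) + β₂ * (1 + Y)) * ‖p - p'‖ := by ring
    -- the step inequalities for the closed forms
    have hXstep : X + |τ| * Y + (α₁ * (k * |τ| + X) + α₂ * (1 + Y)) ≤
        β₁ * |τ| ^ 2 * ((k : ℝ) + 1) ^ 3 + (α₁ + β₂) * |τ| * ((k : ℝ) + 1) ^ 2 + 2 * α₂ * (k + 1) := by
      rw [hX, hY] at *
      nlinarith [mul_nonneg hα₁ hX0, mul_nonneg hα₂ hY0, mul_nonneg hβ₁ (pow_nonneg hτ 2),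
        mul_nonneg hα₁ hτ, mul_nonneg hβ₂ hτ, mul_nonneg (mul_nonneg hβ₁ (pow_nonneg hτ 2)) hkk]
    have hYstep : Y + (β₁ * (k * |τ| + X) + β₂ * (1 + Y)) ≤
        β₁ * |τ| * ((k : ℝ) + 1) ^ 2 + 2 * β₂ * (k + 1) := by
      rw [hX, hY] at *
      nlinarith [mul_nonneg hβ₁ hX0, mul_nonneg hβ₂ hY0, mul_nonneg hβ₁ hτ]
    refine ⟨α', β', fun p => ?_, fun p => ?_, fun p => ?_, fun p p' => ?_, fun p p' => ?_⟩
    · -- the trajectory formula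
      rw [Function.iterate_succ_apply', hW p, hΦ]
      dsimp only
      rw [hα', hβ', Nat.cast_succ]
      refine Prod.ext ?_ ?_
      · dsimp only
        rw [← mul_assoc, ← u1ExpDrift_add']
        congr 2
        rw [add_mul, one_mul, add_smul, smul_add]
        abel
      · dsimp only
        abel
    · -- `‖α'‖`
      rw [hα', Nat.cast_succ]
      dsimp only
      calc ‖α p + τ • β p + A (U p) (p + β p)‖ ≤ ‖α p‖ + ‖τ • β p‖ + ‖A (U p) (p + β p)‖ := norm_add₃_le
        _ ≤ (k * α₀ + |τ| * β₀ * (k : ℝ) ^ 2 / 2) + |τ| * (k * β₀) + α₀ := by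
            rw [norm_smul, Real.norm_eq_abs]
            exact add_le_add (add_le_add (hαb p) (mul_le_mul_of_nonneg_left (hβb p) hτ)) (hA0 _ _)
        _ ≤ ((k : ℝ) + 1) * α₀ + |τ| * β₀ * ((k : ℝ) + 1) ^ 2 / 2 := by
            nlinarith [mul_nonneg hτ hβ0]
    · -- `‖β'‖`
      rw [hβ', Nat.cast_succ]
      dsimp only
      calc ‖β p + B (U p) (p + β p)‖ ≤ ‖β p‖ + ‖B (U p) (p + β p)‖ := norm_add_le _ _
        _ ≤ k * β₀ + β₀ := add_le_add (hβb p) (hB0 _ _)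
        _ = ((k : ℝ) + 1) * β₀ := by ring
    · -- Lipschitz of `α'`
      rw [hα', Nat.cast_succ]
      dsimp only
      calc ‖α p + τ • β p + A (U p) (p + β p) - (α p' + τ • β p' + A (U p') (p' + β p'))‖
          = ‖(α p - α p') + τ • (β p - β p') + (A (U p) (p + β p) - A (U p') (p' + β p'))‖ := by
            rw [smul_sub]; congr 1; abel
        _ ≤ ‖α p - α p'‖ + ‖τ • (β p - β p')‖ + ‖A (U p) (p + β p) - A (U p') (p' + β p')‖ :=
            norm_add₃_le
        _ ≤ X * ‖p - p'‖ + |τ| * (Y * ‖p - p'‖) +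
              (α₁ * (k * |τ| + X) + α₂ * (1 + Y)) * ‖p - p'‖ := by
            rw [norm_smul, Real.norm_eq_abs]
            exact add_le_add (add_le_add (hαL p p') (mul_le_mul_of_nonneg_left (hβL p p') hτ))
              (hAL p p')
        _ = (X + |τ| * Y + (α₁ * (k * |τ| + X) + α₂ * (1 + Y))) * ‖p - p'‖ := by ring
        _ ≤ _ := mul_le_mul_of_nonneg_right hXstep (norm_nonneg _)
    · -- Lipschitz of `β'`
      rw [hβ', Nat.cast_succ]
      dsimp only
      calc ‖β p + B (U p) (p + β p) - (β p' + B (U p') (p' + β p'))‖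
          = ‖(β p - β p') + (B (U p) (p + β p) - B (U p') (p' + β p'))‖ := by congr 1; abel
        _ ≤ ‖β p - β p'‖ + ‖B (U p) (p + β p) - B (U p') (p' + β p')‖ := norm_add_le _ _
        _ ≤ Y * ‖p - p'‖ + (β₁ * (k * |τ| + X) + β₂ * (1 + Y)) * ‖p - p'‖ :=
            add_le_add (hβL p p') (hBL p p')
        _ = (Y + (β₁ * (k * |τ| + X) + β₂ * (1 + Y))) * ‖p - p'‖ := by ring
        _ ≤ _ := mul_le_mul_of_nonneg_right hYstep (norm_nonneg _)

/-- **THE CONFIGURATION AFTER `n` APPLICATIONS IS ONE DRIFT OF A LIPSCHITZ-SMALL PERTURBATION OF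
FREE FLIGHT**: under the hypotheses of `nearFreeFlight_iterate` there is `G_u` with
`‖G_u p‖ ≤ n α₀ + |τ| β₀ n²/2`, `G_u` `(n|τ|/3)`-Lipschitz, and
`(Φ^[n] (u, p)).1 = e₁((nτ) • p + G_u p) · u`. -/
theorem nearFreeFlight_iterate_fst
    (hΦ : ∀ z : (ι → Circle) × (ι → ℝ), Φ z = (u1ExpDrift 1 (τ • z.2 + A z.1 z.2) * z.1, z.2 + B z.1 z.2))
    (hA0 : ∀ v q, ‖A v q‖ ≤ α₀) (hB0 : ∀ v q, ‖B v q‖ ≤ β₀)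
    (hA : ∀ v v' q q', ‖A v q - A v' q'‖ ≤ α₁ * dist v v' + α₂ * ‖q - q'‖)
    (hB : ∀ v v' q q', ‖B v q - B v' q'‖ ≤ β₁ * dist v v' + β₂ * ‖q - q'‖)
    (hα₁ : 0 ≤ α₁) (hα₂ : 0 ≤ α₂) (hβ₁ : 0 ≤ β₁) (hβ₂ : 0 ≤ β₂) {n : ℕ}
    (h1 : 3 * (β₁ * |τ| ^ 2 * (n : ℝ) ^ 2 + (α₁ + β₂) * |τ| * n + 2 * α₂) ≤ |τ|)
    (h2 : β₁ * |τ| * (n : ℝ) ^ 2 + 2 * β₂ * n ≤ 1) (u : ι → Circle) :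
    ∃ G : (ι → ℝ) → ι → ℝ, (∀ p, ‖G p‖ ≤ n * α₀ + |τ| * β₀ * (n : ℝ) ^ 2 / 2) ∧
      LipschitzWith (Real.toNNReal (n * |τ| / 3)) G ∧
      ∀ p, (Φ^[n] (u, p)).1 = u1ExpDrift 1 (((n : ℝ) * τ) • p + G p) * u := by
  obtain ⟨α, β, hW, hαb, -, hαL, -⟩ :=
    nearFreeFlight_iterate hΦ hA0 hB0 hA hB hα₁ hα₂ hβ₁ hβ₂ u h1 h2 n le_rfl
  have hn0 : (0 : ℝ) ≤ n := Nat.cast_nonneg n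
  have hX : β₁ * |τ| ^ 2 * (n : ℝ) ^ 3 + (α₁ + β₂) * |τ| * (n : ℝ) ^ 2 + 2 * α₂ * n ≤ n * |τ| / 3 := by
    have : β₁ * |τ| ^ 2 * (n : ℝ) ^ 3 + (α₁ + β₂) * |τ| * (n : ℝ) ^ 2 + 2 * α₂ * n =
        n * (β₁ * |τ| ^ 2 * (n : ℝ) ^ 2 + (α₁ + β₂) * |τ| * n + 2 * α₂) := by ring
    rw [this]
    nlinarith
  refine ⟨α, hαb, LipschitzWith.of_dist_le_mul fun p p' => ?_, fun p => ?_⟩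
  · rw [Real.coe_toNNReal _ (by positivity), dist_eq_norm, dist_eq_norm]
    exact (hαL p p').trans (mul_le_mul_of_nonneg_right hX (norm_nonneg _))
  · rw [hW p]

/-- **The momentum after `n` applications stays within `n β₀` of the initial one.** -/
theorem nearFreeFlight_iterate_snd
    (hΦ : ∀ z : (ι → Circle) × (ι → ℝ), Φ z = (u1ExpDrift 1 (τ • z.2 + A z.1 z.2) * z.1, z.2 + B z.1 z.2))
    (hA0 : ∀ v q, ‖A v q‖ ≤ α₀) (hB0 : ∀ v q, ‖B v q‖ ≤ β₀)
    (hA : ∀ v v' q q', ‖A v q - A v' q'‖ ≤ α₁ * dist v v' + α₂ * ‖q - q'‖)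
    (hB : ∀ v v' q q', ‖B v q - B v' q'‖ ≤ β₁ * dist v v' + β₂ * ‖q - q'‖)
    (hα₁ : 0 ≤ α₁) (hα₂ : 0 ≤ α₂) (hβ₁ : 0 ≤ β₁) (hβ₂ : 0 ≤ β₂) {n : ℕ}
    (h1 : 3 * (β₁ * |τ| ^ 2 * (n : ℝ) ^ 2 + (α₁ + β₂) * |τ| * n + 2 * α₂) ≤ |τ|)
    (h2 : β₁ * |τ| * (n : ℝ) ^ 2 + 2 * β₂ * n ≤ 1) (u : ι → Circle) (p : ι → ℝ) :
    ‖(Φ^[n] (u, p)).2 - p‖ ≤ n * β₀ := by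
  obtain ⟨α, β, hW, -, hβb, -, -⟩ :=
    nearFreeFlight_iterate hΦ hA0 hB0 hA hB hα₁ hα₂ hβ₁ hβ₂ u h1 h2 n le_rfl
  rw [hW p]
  dsimp only
  rw [add_sub_cancel_left]
  exact hβb p

end Power

end Summit.Ventures.LatticeQCDFlow.Exactness
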